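import Summits.CriticalPhenomena.PercolationContinuityZ3.Theorems.PercNearOneGluingNoHeavyQuantTopTwoCore
import HarnessLib

/-!
# QUANT lane R8, T-DEC: THE SIBLING STEP FOR TOP-2 SIBLINGS, k-GENERAL — II. every forest of 2-chains (indeed of siblings whose
# sub-forest laws live on `{0,1,2}`), EVERY WIDTH, EVERY ROOT GATE, is SDEC at every per-sibling-affordable floor; no oracle,
# no certificate (arm-1 gen 56, architect)

builds on p205010 (kernel theorem, internal audit signed; external expert review pending)

Support file (`--supports stmt-CriticalPhenomena-4575`), QUANT lane seat prim-quant-arm-1 (gen 56, architect); memo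
`run/shared/lean/prim/quant/prim-quant-arm-1-g56/ARCH-G56.md`.  Theorems only (file-local notation, no definitions); standard axioms,
no sorries.  Mechanism and tools: `…QuantTopTwoCore` (part I).

THE THEOREM.  For every list `L` of law-OK siblings `gate ρᵢ qᵢ` with sub-forest laws `ρᵢ` on `{0,1,2}` (declared top `Mᵢ = 2`: every
2-chain `R[qᵢ](R[pᵢ])`, every relay with one relay child, every non-relay vertex carrying at most two nested relays, …) and every floor
`0 < x` with `2·x ≤ qᵢ·mean ρᵢ` for every `i` (PER-SIBLING AFFORDABILITY — automatic for tree-OK siblings):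
**`SDEC x (ftop L) (flaw L)`** (`sdec_flaw_of_topTwo`) — any width, any root gates, no oracle (no induction hypothesis), no machine
certificate.  COROLLARIES: **`sdec_flaw_of_topTwo_treeOK`** — the node `LawDec.SiblingStep`, in its list binder (`siblingStep_iff_list`),
HOLDS for every forest of top-2 siblings, unconditionally; **`sdec_forest_twoChain`** — every forest of 2-chains `R[qᵢ](R[pᵢ])`
(`0 < qᵢ < 1`, `0 ≤ pᵢ ≤ 1`), any number of them, at every floor `2x ≤ minᵢ qᵢ(1+pᵢ)`: the k-general form of arm-1 g54/g55's `sdec_tc3` /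
`sdec_tc3g` / `sdec_triple_twoChain` (k = 3, eleven Handelman certificates) and of census-1 g28's `sdec_symForest_twoChain_light` AT TREE-OK
FLOORS.  Honest scope: `sdec_tc3g` keeps the larger floor range `6x ≤ Σ mᵢ` for k = 3; this file covers `2x ≤ min mᵢ`, which contains every
tree-OK floor — what the gate-elimination induction (`SiblingStep`) asks.

THE PROOF.  Induction on the list with a NEAR-SURE CORE universally quantified (`sdec_core_flaw`): the new sibling's gated law is a same-mean
mixture of the double blob (sliced in last), and the relay (sliced in last) or the near-sure extreme (joins the core); part I supplies the
core (`sdec_core`: no positive low atom), the chords, the slices and the assembly (`sdec_topTwo_assemble`).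

HONEST STATUS.  `SiblingStep` / `GateStepN` / `LightResidDECOracle` / `FarTreeRow` remain OPEN for siblings of top `≥ 3`: the same reduction
(two-point extremes `{lo, hi; γ}` of each sibling's gated law; `lo = 0` or `γ ≥ x` are slices) leaves exactly the HUB-CORE "sure relays +
under-floor blobs of size `≥ 2`" (memo ARCH-G56 §2); RATE class (log\*) / honest sentence of `run/shared/lean/prim/quant/README.md`
unchanged.  [this work].  Nothing here is cited as a published result.  The gluing rows served [cite: KozmaNitzan2024, Conjecture 3 (p. 15)];
product measure [cite: Grimmett1999, §1.3 p. 10].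
-/

noncomputable section

open scoped BigOperators

namespace Summit.CriticalPhenomena.PercolationContinuityZ3.Theorems
namespace Quant
namespace LawDec

open Finset

/-- the point mass `δ_K` -/
local notation3 "δ[" K "]" => (fun k : ℕ => if k = (K : ℕ) then (1 : ℝ) else 0)

/-- the 2-chain sub-forest law `ρ_p = δ₁ ∗ gate_p δ₁ = {1: 1−p, 2: p}` -/
local notation3 "ρ₂[" p "]" => lconv 1 1 (fun k : ℕ => if k = (1 : ℕ) then (1 : ℝ) else 0)
  (gate (fun k : ℕ => if k = (1 : ℕ) then (1 : ℝ) else 0) p)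

/-- the near-sure extreme as a pseudo-sibling with the sure root gate `1` -/
local notation3 "CS[" r "]" => (⟨1, 0, 0, 2, ρ₂[r]⟩ : Sib)

/-- the near-sure core of inner gates `rs` (`flaw CORE[rs]` = law of `|rs| + Σ_j Bern(r_j)`, top `ftop CORE[rs] = 2|rs|`) -/
local notation3 "CORE[" rs "]" => List.map (fun r : ℝ => CS[r]) rs

/-- the 2-chain sibling `t = gate_q(δ₁ ∗ gate_p δ₁)` with recorded sub-floor `x₁` and gate count `1` -/
local notation3 "TC[" q ", " p ", " x₁ "]" => (⟨q, x₁, 1, 2, ρ₂[p]⟩ : Sib)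

/-! ### The induction: near-sure core ∗ forest of top-2 siblings -/

/-- `x·ftop L ≤ fmean L` for top-2 siblings at a per-sibling-affordable floor. [this work] -/
theorem floor_ftop_le_fmean (x : ℝ) : ∀ L : List Sib, (∀ s ∈ L, s.LawOK ∧ s.M = 2) → (∀ s ∈ L, 2 * x ≤ s.q * s.mean) →
    x * (ftop L : ℝ) ≤ fmean L
  | [], _, _ => by simp [ftop, fmean]
  | s :: L, hL, hx => by
    have ih := floor_ftop_le_fmean x L (fun t ht => hL t (List.mem_cons_of_mem s ht)) (fun t ht => hx t (List.mem_cons_of_mem s ht))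
    obtain ⟨_, hM⟩ := hL s List.mem_cons_self
    have hxs := hx s List.mem_cons_self
    simp only [ftop, fmean, hM, Nat.cast_add, Nat.cast_ofNat]
    linarith

/-- **law facts of `flaw CORE[rs] ∗ flaw L`**: a probability law on `{0..2|rs| + ftop L}` of mean `|rs| + Σ rs + fmean L`, top-affordable at `x`.
[this work] -/
theorem core_flaw_facts (x : ℝ) (rs : List ℝ) (L : List Sib) (hL : ∀ s ∈ L, s.LawOK ∧ s.M = 2)
    (hxL : ∀ s ∈ L, 2 * x ≤ s.q * s.mean) (hrs : ∀ r ∈ rs, 0 ≤ r ∧ r ≤ 1) (hxr : ∀ r ∈ rs, 2 * x ≤ 1 + r) :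
    (∀ h, 0 ≤ lconv (ftop CORE[rs]) (ftop L) (flaw CORE[rs]) (flaw L) h) ∧
    (∀ h, ftop CORE[rs] + ftop L < h → lconv (ftop CORE[rs]) (ftop L) (flaw CORE[rs]) (flaw L) h = 0) ∧
    (∑ h ∈ Finset.range (ftop CORE[rs] + ftop L + 1), lconv (ftop CORE[rs]) (ftop L) (flaw CORE[rs]) (flaw L) h = 1) ∧
    (∑ h ∈ Finset.range (ftop CORE[rs] + ftop L + 1), (h : ℝ) * lconv (ftop CORE[rs]) (ftop L) (flaw CORE[rs]) (flaw L) h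
        = (rs.length + rs.sum) + fmean L) ∧
    x * ((ftop CORE[rs] + ftop L : ℕ) : ℝ) ≤ (rs.length + rs.sum) + fmean L := by
  obtain ⟨c0, cM, c1, cmn, _⟩ := core_facts rs hrs
  obtain ⟨f0, fM, f1, fmn⟩ := flaw_facts L (fun t ht => (hL t ht).1)
  obtain ⟨hsx, _⟩ := core_sum_bounds x rs (fun r hr => (hrs r hr).2) hxr
  have hfl := floor_ftop_le_fmean x L hL hxL
  refine ⟨lconv_nonneg _ _ _ _ c0 f0, fun h hh => lconv_eq_zero _ _ _ _ h hh, sum_lconv _ _ _ _ c1 f1,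
    by rw [sum_mul_lconv _ _ _ _ c1 f1, cmn, fmn], ?_⟩
  rw [Nat.cast_add, ftop_core]; push_cast; nlinarith

/-- **the induction step**: adding one top-2 sibling `s` to `flaw CORE[rs] ∗ flaw L`, given the conclusion for `(rs, L)` and for every enlarged
core `(r :: rs, L)`. [this work] -/
theorem sdec_core_flaw_step {x : ℝ} (hx0 : 0 < x) (hx1 : x < 1) (rs : List ℝ) (L : List Sib) (s : Sib)
    (hL : ∀ t ∈ L, t.LawOK ∧ t.M = 2) (hxL : ∀ t ∈ L, 2 * x ≤ t.q * t.mean) (hs : s.LawOK) (hM : s.M = 2)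
    (hxs : 2 * x ≤ s.q * s.mean) (hrs : ∀ r ∈ rs, 0 ≤ r ∧ r ≤ 1) (hxr : ∀ r ∈ rs, 2 * x ≤ 1 + r)
    (ih : SDEC x (ftop CORE[rs] + ftop L) (lconv (ftop CORE[rs]) (ftop L) (flaw CORE[rs]) (flaw L)))
    (ihC : ∀ r : ℝ, 0 ≤ r → r ≤ 1 → 2 * x ≤ 1 + r →
      SDEC x (ftop CORE[r :: rs] + ftop L) (lconv (ftop CORE[r :: rs]) (ftop L) (flaw CORE[r :: rs]) (flaw L))) :
    SDEC x (ftop CORE[rs] + ftop (s :: L)) (lconv (ftop CORE[rs]) (ftop (s :: L)) (flaw CORE[rs]) (flaw (s :: L))) := by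
  obtain ⟨hq0, hq1, ρ0, ρM, ρ1⟩ := hs
  rw [hM] at ρM ρ1
  obtain ⟨c0, cM, c1, cmn, _⟩ := core_facts rs hrs
  obtain ⟨f0, fM, f1, fmn⟩ := flaw_facts L (fun t ht => (hL t ht).1)
  obtain ⟨a0, aM, a1, amn, ata⟩ := core_flaw_facts x rs L hL hxL hrs hxr
  rw [← amn] at ata
  -- the new sibling's gated law `t` on `{0,1,2}` and its mean `m = q·mean ρ`
  simp only [ftop, flaw, hM]
  obtain ⟨t0, tM, t1⟩ := gate_laws 2 s.ρ s.q hq0.le hq1.le ρ0 ρM ρ1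
  have t1' : gate s.ρ s.q 0 + gate s.ρ s.q 1 + gate s.ρ s.q 2 = 1 := by
    have := t1; simp only [Finset.sum_range_succ, Finset.sum_range_zero, zero_add] at this; exact this
  have hmean : s.mean = s.ρ 1 + 2 * s.ρ 2 := by
    simp only [Sib.mean, hM, Finset.sum_range_succ, Finset.sum_range_zero]; push_cast; ring
  have hm : gate s.ρ s.q 1 + 2 * gate s.ρ s.q 2 = s.q * s.mean := by
    rw [hmean, gate_apply, gate_apply]; simp; ring
  have ht0pos : 0 < gate s.ρ s.q 0 := by
    rw [gate_apply]; simp; nlinarith [ρ0 0]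
  have hm2 : s.q * s.mean < 2 := by rw [← hm]; linarith [t0 1, t0 2]
  have hm0 : 0 < s.q * s.mean := by linarith
  refine sdec_topTwo_assemble (s.q * s.mean) c1 f1 t0 tM t1' hm hm0 hm2 ?_ (fun hm1 => ?_) (fun hm1 => ?_)
  · -- the double blob: size 2, gate m/2 ≥ x
    exact sdec_lconv_lconv_blob hx0 hx1 (by linarith) (by linarith) (by norm_num) le_rfl (by push_cast; linarith)
      a0 aM a1 ata ih
  · -- the relay: size 1, gate m ≥ 2x (declared top 2: raise the top by one)
    exact sdec_lconv_lconv_blob hx0 hx1 (by linarith) hm1 le_rfl (by norm_num) (by push_cast; linarith) a0 aM a1 ata ih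
  · -- the near-sure extreme joins the core
    have ih' := ihC (s.q * s.mean - 1) (by linarith) (by linarith) (by linarith)
    rw [flaw_core_cons, show ftop CORE[(s.q * s.mean - 1) :: rs] = ftop CORE[rs] + 2 by simp only [List.map_cons, ftop]] at ih'
    rw [lconv_lconv_right_comm, show ftop CORE[rs] + (ftop L + 2) = ftop CORE[rs] + 2 + ftop L by omega]
    exact ih'

/-- **CORE ∗ FOREST.**  For `0 < x < 1`, a list `L` of law-OK top-2 siblings with `2x ≤ qᵢ·mean ρᵢ` and a near-sure core `rs` (`0 ≤ r_j ≤ 1`,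
`2x ≤ 1 + r_j`): `flaw CORE[rs] ∗ flaw L` is SDEC at `x` on `{0..2|rs| + ftop L}` — induction on `L`, the core universally quantified. [this work] -/
theorem sdec_core_flaw {x : ℝ} (hx0 : 0 < x) (hx1 : x < 1) :
    ∀ (L : List Sib) (rs : List ℝ), (∀ s ∈ L, s.LawOK ∧ s.M = 2) → (∀ s ∈ L, 2 * x ≤ s.q * s.mean) →
      (∀ r ∈ rs, 0 ≤ r ∧ r ≤ 1) → (∀ r ∈ rs, 2 * x ≤ 1 + r) →
      SDEC x (ftop CORE[rs] + ftop L) (lconv (ftop CORE[rs]) (ftop L) (flaw CORE[rs]) (flaw L))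
  | [], rs, _, _, hrs, hxr => by
    obtain ⟨_, cM, _, _, _⟩ := core_facts rs hrs
    have e : lconv (ftop CORE[rs]) (ftop []) (flaw CORE[rs]) (flaw []) = flaw CORE[rs] := by
      funext h; simp only [ftop, flaw]; exact lconv_delta_right _ _ _ cM h
    rw [e]
    simp only [ftop, Nat.add_zero]
    exact sdec_core hx0 hx1 rs hrs hxr
  | s :: L, rs, hL, hxL, hrs, hxr => by
    have hL' : ∀ t ∈ L, t.LawOK ∧ t.M = 2 := fun t ht => hL t (List.mem_cons_of_mem s ht)
    have hxL' : ∀ t ∈ L, 2 * x ≤ t.q * t.mean := fun t ht => hxL t (List.mem_cons_of_mem s ht)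
    obtain ⟨hs, hM⟩ := hL s List.mem_cons_self
    refine sdec_core_flaw_step hx0 hx1 rs L s hL' hxL' hs hM (hxL s List.mem_cons_self) hrs hxr
      (sdec_core_flaw hx0 hx1 L rs hL' hxL' hrs hxr) fun r hr0 hr1 hxr1 => ?_
    refine sdec_core_flaw hx0 hx1 L (r :: rs) hL' hxL' (fun r' hr' => ?_) (fun r' hr' => ?_)
    · rcases List.mem_cons.1 hr' with rfl | hr'
      · exact ⟨hr0, hr1⟩
      · exact hrs r' hr'
    · rcases List.mem_cons.1 hr' with rfl | hr'
      · exact hxr1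
      · exact hxr r' hr'

/-! ### The theorems -/

/-- **THE SIBLING STEP FOR TOP-2 SIBLINGS, k-GENERAL.**  For every list `L` of law-OK siblings with sub-forest laws on `{0,1,2}` (`sᵢ.M = 2`)
and every floor `0 < x` with `2·x ≤ qᵢ·mean ρᵢ` for all `i`: `SDEC x (ftop L) (flaw L)` — every width, every root gate, no oracle,
no certificate. [this work] -/
theorem sdec_flaw_of_topTwo {x : ℝ} (hx0 : 0 < x) (L : List Sib) (hL : ∀ s ∈ L, s.LawOK ∧ s.M = 2)
    (hx : ∀ s ∈ L, 2 * x ≤ s.q * s.mean) : SDEC x (ftop L) (flaw L) := by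
  rcases L with _ | ⟨s, L⟩
  · intro a _ _ j hj; simp [ftop] at hj
  · -- `x < 1`: `2x ≤ q·mean ρ ≤ 2q < 2`
    obtain ⟨⟨hq0, hq1, ρ0, ρM, ρ1⟩, hM⟩ := hL s List.mem_cons_self
    have hxs := hx s List.mem_cons_self
    rw [hM] at ρM ρ1
    have hmean : s.mean ≤ 2 := by
      have e : s.mean = s.ρ 1 + 2 * s.ρ 2 := by
        simp only [Sib.mean, hM, Finset.sum_range_succ, Finset.sum_range_zero]; push_cast; ring
      have e1 : s.ρ 0 + s.ρ 1 + s.ρ 2 = 1 := by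
        have := ρ1; simp only [Finset.sum_range_succ, Finset.sum_range_zero, zero_add] at this; exact this
      rw [e]; nlinarith [ρ0 0, ρ0 1]
    have hx1 : x < 1 := by nlinarith
    obtain ⟨_, fM, _, _⟩ := flaw_facts (s :: L) (fun t ht => (hL t ht).1)
    have h := sdec_core_flaw hx0 hx1 (s :: L) [] hL hx (fun r hr => by simp at hr) (fun r hr => by simp at hr)
    have e : lconv (ftop CORE[([] : List ℝ)]) (ftop (s :: L)) (flaw CORE[([] : List ℝ)]) (flaw (s :: L)) = flaw (s :: L) := by
      funext h; simp only [List.map_nil, flaw]; exact lconv_delta_left _ _ _ fM h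
    rw [e] at h
    simpa [ftop] using h

/-- **THE NODE `SiblingStep` HOLDS FOR FORESTS OF TOP-2 SIBLINGS, UNCONDITIONALLY** (list binder of `siblingStep_iff_list`, no oracle, any
width): tree-OK siblings at `x` with `sᵢ.M = 2` ⟹ `SDEC x (ftop L) (flaw L)`.  (Per-sibling affordability from tree-OK: `x ≤ qᵢ·x₁ᵢ` and
`x₁ᵢ·Mᵢ ≤ mean ρᵢ`.) [this work] -/
theorem sdec_flaw_of_topTwo_treeOK {x : ℝ} (hx0 : 0 < x) (L : List Sib) (hL : ∀ s ∈ L, s.TreeOK x) (h2 : ∀ s ∈ L, s.M = 2) :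
    SDEC x (ftop L) (flaw L) := by
  refine sdec_flaw_of_topTwo hx0 L (fun s hs => ⟨(hL s hs).lawOK, h2 s hs⟩) fun s hs => ?_
  obtain ⟨hq0, _, hxq, hT, _⟩ := hL s hs
  obtain ⟨_, _, _, _, _, hta⟩ := hT.lawFacts
  have hM := h2 s hs
  have hta' : s.x₁ * 2 ≤ s.mean := by
    have : s.x₁ * (s.M : ℝ) ≤ s.mean := hta
    rw [hM] at this; exact_mod_cast this
  nlinarith

/-- law-OK data of a 2-chain sibling. [this work] -/
theorem tc_lawOK_topTwo {q p : ℝ} (hq0 : 0 < q) (hq1 : q < 1) (hp0 : 0 ≤ p) (hp1 : p ≤ 1) (x₁ : ℝ) :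
    (TC[q, p, x₁]).LawOK ∧ (TC[q, p, x₁]).M = 2 ∧ (TC[q, p, x₁]).q * (TC[q, p, x₁]).mean = q * (1 + p) := by
  obtain ⟨l0, lM, l1, lmn, _⟩ := lawC_facts p hp0 hp1
  exact ⟨⟨hq0, hq1, l0, lM, l1⟩, rfl, by simp only [Sib.mean]; rw [lmn]⟩

/-- **EVERY FOREST OF 2-CHAINS IS SDEC AT EVERY FLOOR `2x ≤ minᵢ qᵢ(1+pᵢ)`** — k-general form of `sdec_tc3g` / `sdec_triple_twoChain` (k = 3)
and `sdec_symForest_twoChain_light` at tree-OK floors: siblings `R[qᵢ](R[pᵢ])` (`0 < qᵢ < 1`, `0 ≤ pᵢ ≤ 1`, recorded sub-floors arbitrary),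
any number of them, no oracle, no certificate. [this work] -/
theorem sdec_forest_twoChain {x : ℝ} (hx0 : 0 < x) (P : List (ℝ × ℝ × ℝ))
    (hP : ∀ e ∈ P, 0 < e.1 ∧ e.1 < 1 ∧ 0 ≤ e.2.1 ∧ e.2.1 ≤ 1 ∧ 2 * x ≤ e.1 * (1 + e.2.1)) :
    SDEC x (ftop (P.map fun e => TC[e.1, e.2.1, e.2.2])) (flaw (P.map fun e => TC[e.1, e.2.1, e.2.2])) := by
  refine sdec_flaw_of_topTwo hx0 _ (fun s hs => ?_) (fun s hs => ?_)
  · obtain ⟨e, he, rfl⟩ := List.mem_map.1 hs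
    obtain ⟨hq0, hq1, hp0, hp1, _⟩ := hP e he
    obtain ⟨h1, h2, _⟩ := tc_lawOK_topTwo hq0 hq1 hp0 hp1 e.2.2
    exact ⟨h1, h2⟩
  · obtain ⟨e, he, rfl⟩ := List.mem_map.1 hs
    obtain ⟨hq0, hq1, hp0, hp1, hx⟩ := hP e he
    obtain ⟨_, _, h3⟩ := tc_lawOK_topTwo hq0 hq1 hp0 hp1 e.2.2
    rw [h3]; exact hx

end LawDec
end Quant
end Summit.CriticalPhenomena.PercolationContinuityZ3.Theorems
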